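import Summits.Ventures.PercRepro.S1CoreCapSpec

/-!
# PercRepro — FREE SEQUENCES OF 3-POINT LINES (p1, gen 24; towards `Q*(5) = 11`)

The cost bookkeeping of the 4-circuit-cap spec (`S1CoreCapSpec`) for 3-POINT LINES, relative to a set `P₀` of
points covered beforehand: a 3-point line added to a union `U` raises `|U|` by `|L ∖ U|` and the rank bound by
`min |L ∖ U| (2 − min |L ∩ U| 2)`, and the difference is `1` if `L ⊄ U` and `0` if `L ⊆ U` (`card_unionLR`:
`|unionLR P₀ l| = |P₀| + lineRankR P₀ l + freeCountR P₀ l`). So a list of 3-point lines costs exactly its number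
of FREE lines — those not covered by `P₀` and the lines after them — plus the fat points it introduces. The MASTER
INEQUALITY (`freeCountR_add_fat_le`) is the spec's cost clause in these terms, for a list `l` of 3-point lines
placed after any list `l₀`: `|unionL l₀| + freeCountR (unionL l₀) l + fat (unionLR (unionL l₀) l) ≤ ν + lineRank l₀`.
THE COUNTING LEMMA (`two_mul_card_le_of_freeCountR`): a family of 3-point lines, pairwise sharing `≤ 1` point and
each meeting `P₀` in `≤ 1` point, whose every list has `≤ k` free lines, has at most `k (k + 1) / 2` members — the
lines through a point `v ∉ P₀` form a free sequence (`freeCountR_eq_length_of_mem`), and the lines avoiding `v`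
have one unit of budget less (prepend a line through `v`). `proofs/P1-S4-CAPBRIDGE.md` §16. Axioms: standard.
-/

namespace PercRepro

namespace S1

namespace FourCap

variable {β : Type} [DecidableEq β]

/-- The union of a list of lines over a set `P₀` of points covered beforehand (the head is added last). -/
def unionLR (P₀ : Finset β) : List (Finset β) → Finset β
  | [] => P₀
  | L :: l => L ∪ unionLR P₀ l

/-- The search's rank bound for a list of lines over `P₀` (as `lineRank`, with `P₀` counted as already covered). -/
def lineRankR (P₀ : Finset β) : List (Finset β) → ℕ
  | [] => 0
  | L :: l => lineRankR P₀ l + min (L \ unionLR P₀ l).card (2 - min (L ∩ unionLR P₀ l).card 2)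

/-- The number of FREE lines of a list over `P₀`: those not contained in `P₀` and the lines after them. -/
def freeCountR (P₀ : Finset β) : List (Finset β) → ℕ
  | [] => 0
  | L :: l => freeCountR P₀ l + (if L ⊆ unionLR P₀ l then 0 else 1)

/-- Over `P₀ = ∅` the relative union is the union. -/
theorem unionLR_empty : ∀ l : List (Finset β), unionLR ∅ l = unionL l
  | [] => rfl
  | L :: l => by simp only [unionLR, unionL, unionLR_empty l]

/-- Over `P₀ = ∅` the relative rank bound is `lineRank`. -/
theorem lineRankR_empty : ∀ l : List (Finset β), lineRankR ∅ l = lineRank l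
  | [] => rfl
  | L :: l => by simp only [lineRankR, lineRank, lineRankR_empty l, unionLR_empty]

/-- The union of `l ++ l₀` is the union of `l` over the union of `l₀`. -/
theorem unionL_append (l l₀ : List (Finset β)) : unionL (l ++ l₀) = unionLR (unionL l₀) l := by
  induction l with
  | nil => rfl
  | cons L l ih => simp only [List.cons_append, unionL, unionLR, ih]

/-- The rank bound of `l ++ l₀` is the relative rank bound of `l` over the union of `l₀` plus that of `l₀`. -/
theorem lineRank_append (l l₀ : List (Finset β)) :
    lineRank (l ++ l₀) = lineRankR (unionL l₀) l + lineRank l₀ := by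
  induction l with
  | nil => simp [lineRankR]
  | cons L l ih => simp only [List.cons_append, lineRank, lineRankR, ih, unionL_append]; omega

/-- `P₀` lies in every relative union. -/
theorem subset_unionLR (P₀ : Finset β) : ∀ l : List (Finset β), P₀ ⊆ unionLR P₀ l
  | [] => Finset.Subset.refl _
  | _ :: l => (subset_unionLR P₀ l).trans Finset.subset_union_right

/-- Membership in a relative union. -/
theorem mem_unionLR_iff {P₀ : Finset β} {v : β} :
    ∀ {l : List (Finset β)}, v ∈ unionLR P₀ l ↔ v ∈ P₀ ∨ ∃ L ∈ l, v ∈ L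
  | [] => by simp [unionLR]
  | L :: l => by
    simp only [unionLR, Finset.mem_union, List.mem_cons, exists_eq_or_imp]
    rw [mem_unionLR_iff]
    tauto

/-- A point of a line of the list lies in the relative union. -/
theorem mem_unionLR_of_mem {P₀ : Finset β} {l : List (Finset β)} {L : Finset β} (hL : L ∈ l) {v : β}
    (hv : v ∈ L) : v ∈ unionLR P₀ l :=
  mem_unionLR_iff.2 (Or.inr ⟨L, hL, hv⟩)

/-- **THE COST IDENTITY FOR 3-POINT LINES**: the relative union of a list of 3-point lines has exactly
`|P₀| + lineRankR + freeCountR` points — each line adds its new points, of which the rank bound absorbs all but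
one when the line is free and all when it is covered. -/
theorem card_unionLR (P₀ : Finset β) :
    ∀ l : List (Finset β), (∀ L ∈ l, L.card = 3) →
      (unionLR P₀ l).card = P₀.card + lineRankR P₀ l + freeCountR P₀ l
  | [], _ => by simp [unionLR, lineRankR, freeCountR]
  | L :: l, h3 => by
    have ih := card_unionLR P₀ l (fun L' hL' => h3 L' (List.mem_cons_of_mem _ hL'))
    have hL3 : L.card = 3 := h3 L List.mem_cons_self
    set U := unionLR P₀ l with hU
    have hsplit : (L \ U).card + (L ∩ U).card = L.card := Finset.card_sdiff_add_card_inter L U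
    have hunion : (L \ U).card + U.card = (L ∪ U).card := Finset.card_sdiff_add_card L U
    simp only [unionLR, lineRankR, freeCountR, ← hU]
    by_cases hsub : L ⊆ U
    · have h0 : (L \ U).card = 0 := by
        rw [Finset.card_eq_zero, Finset.sdiff_eq_empty_iff_subset]; exact hsub
      simp only [hsub, if_true]
      omega
    · have hpos : 0 < (L \ U).card := by
        rw [Finset.card_pos]
        obtain ⟨v, hvL, hvU⟩ := Finset.not_subset.1 hsub
        exact ⟨v, Finset.mem_sdiff.2 ⟨hvL, hvU⟩⟩
      simp only [hsub, if_false]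
      omega

/-- **THE MASTER INEQUALITY**: the spec's cost clause for a list `l` of 3-point lines placed after a list `l₀`,
in terms of free lines and fat points: `|unionL l₀| + freeCountR (unionL l₀) l + fat (unionLR (unionL l₀) l)
≤ ν + lineRank l₀`. -/
theorem freeCountR_add_fat_le {w : β → ℕ} {ls : Finset (Finset β)} {ν : ℕ}
    (h1 : ∀ L ∈ ls, ∀ v ∈ L, w v = 1 ∨ w v = 2)
    (h4 : ∀ l : List (Finset β), l.Nodup → (∀ L ∈ l, L ∈ ls) → wsum w (unionL l) ≤ ν + lineRank l)
    (l₀ l : List (Finset β)) (hnd : (l ++ l₀).Nodup) (hls : ∀ L ∈ l ++ l₀, L ∈ ls) (h3 : ∀ L ∈ l, L.card = 3) :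
    (unionL l₀).card + freeCountR (unionL l₀) l + fat w (unionLR (unionL l₀) l) ≤ ν + lineRank l₀ := by
  have hc := h4 (l ++ l₀) hnd hls
  rw [unionL_append, lineRank_append] at hc
  have hw : ∀ v ∈ unionLR (unionL l₀) l, w v = 1 ∨ w v = 2 := by
    intro v hv
    rcases mem_unionLR_iff.1 hv with hv | ⟨L, hL, hvL⟩
    · obtain ⟨L, hL, hvL⟩ := mem_unionL_iff.1 hv
      exact h1 L (hls L (List.mem_append_right _ hL)) v hvL
    · exact h1 L (hls L (List.mem_append_left _ hL)) v hvL
  rw [wsum_eq_card_add_fat w _ hw, card_unionLR (unionL l₀) l h3] at hc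
  omega

/-- A line with a point off `P₀` and off every line of the list is free: the free count rises by one. -/
theorem freeCountR_cons_of_new {P₀ : Finset β} {l : List (Finset β)} {L : Finset β} {v : β} (hvL : v ∈ L)
    (hvP : v ∉ P₀) (hvl : ∀ L' ∈ l, v ∉ L') : freeCountR P₀ (L :: l) = freeCountR P₀ l + 1 := by
  have hnot : ¬ L ⊆ unionLR P₀ l := by
    intro hsub
    rcases mem_unionLR_iff.1 (hsub hvL) with h | ⟨L', hL', hv'⟩
    · exact hvP h
    · exact hvl L' hL' hv'
  simp only [freeCountR, hnot, if_false]

/-- **The lines through a point off `P₀` form a free sequence**: a list of distinct 3-point lines through `v ∉ P₀`,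
each meeting `P₀` in `≤ 1` point and pairwise sharing `≤ 1` point, has every line free (a second point of the line
off `P₀` lies on no other line through `v`). -/
theorem freeCountR_eq_length_of_mem (P₀ : Finset β) {v : β} (hv : v ∉ P₀) :
    ∀ l : List (Finset β), l.Nodup → (∀ L ∈ l, L.card = 3 ∧ v ∈ L ∧ (L ∩ P₀).card ≤ 1) →
      (∀ L ∈ l, ∀ L' ∈ l, L ≠ L' → (L ∩ L').card ≤ 1) → freeCountR P₀ l = l.length
  | [], _, _, _ => rfl
  | L :: l, hnd, hall, hpair => by
    have ih := freeCountR_eq_length_of_mem P₀ hv l (List.nodup_cons.1 hnd).2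
      (fun L' hL' => hall L' (List.mem_cons_of_mem _ hL'))
      (fun L' hL' L'' hL'' hne => hpair L' (List.mem_cons_of_mem _ hL') L'' (List.mem_cons_of_mem _ hL'') hne)
    obtain ⟨hL3, hvL, hLP⟩ := hall L List.mem_cons_self
    -- a second point of `L` off `P₀`
    have hsd : 1 < (L \ P₀).card := by
      have := Finset.card_sdiff_add_card_inter L P₀
      omega
    obtain ⟨x, hx, hxv⟩ := Finset.exists_mem_ne hsd v
    have hxL : x ∈ L := (Finset.mem_sdiff.1 hx).1
    have hxP : x ∉ P₀ := (Finset.mem_sdiff.1 hx).2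
    have hxl : ∀ L' ∈ l, x ∉ L' := by
      intro L' hL' hxL'
      have hne : L ≠ L' := fun h => (List.nodup_cons.1 hnd).1 (h ▸ hL')
      have hint := hpair L List.mem_cons_self L' (List.mem_cons_of_mem _ hL') hne
      have hvL' := (hall L' (List.mem_cons_of_mem _ hL')).2.1
      exact hxv (Finset.card_le_one.1 hint x (Finset.mem_inter.2 ⟨hxL, hxL'⟩) v (Finset.mem_inter.2 ⟨hvL, hvL'⟩))
    rw [freeCountR_cons_of_new hxL hxP hxl, ih]
    rfl

/-- The lines of a finset through a point, as a free sequence: their number is the free count of their list. -/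
theorem card_filter_le_of_freeCountR_le (P₀ : Finset β) (T : Finset (Finset β)) {v : β} (hv : v ∉ P₀)
    (hT : ∀ L ∈ T, L.card = 3 ∧ (L ∩ P₀).card ≤ 1)
    (hpair : ∀ L ∈ T, ∀ L' ∈ T, L ≠ L' → (L ∩ L').card ≤ 1) {k : ℕ}
    (hk : ∀ l : List (Finset β), l.Nodup → (∀ L ∈ l, L ∈ T) → freeCountR P₀ l ≤ k) :
    (T.filter (fun L => v ∈ L)).card ≤ k := by
  set A := T.filter (fun L => v ∈ L) with hA
  have hmem : ∀ L ∈ A.toList, L ∈ T ∧ v ∈ L := fun L hL => Finset.mem_filter.1 (Finset.mem_toList.1 hL)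
  have h := hk A.toList (Finset.nodup_toList A) (fun L hL => (hmem L hL).1)
  rw [freeCountR_eq_length_of_mem P₀ hv A.toList (Finset.nodup_toList A)
    (fun L hL => ⟨(hT L (hmem L hL).1).1, (hmem L hL).2, (hT L (hmem L hL).1).2⟩)
    (fun L hL L' hL' hne => hpair L (hmem L hL).1 L' (hmem L' hL').1 hne), Finset.length_toList] at h
  exact h

/-- **THE COUNTING LEMMA**: a family `T` of 3-point lines, pairwise sharing `≤ 1` point and each meeting `P₀` in
`≤ 1` point, whose every list has at most `k` free lines over `P₀`, has `2 · #T ≤ k (k + 1)`. Induction on `k`: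
through a point `v` of a line of `T` off `P₀` pass at most `k` lines (a free sequence), and the lines avoiding `v`
have at most `k − 1` free lines in any list (prepend the line through `v`, which is free since `v` is new). -/
theorem two_mul_card_le_of_freeCountR (P₀ : Finset β) :
    ∀ (k : ℕ) (T : Finset (Finset β)), (∀ L ∈ T, L.card = 3 ∧ (L ∩ P₀).card ≤ 1) →
      (∀ L ∈ T, ∀ L' ∈ T, L ≠ L' → (L ∩ L').card ≤ 1) →
      (∀ l : List (Finset β), l.Nodup → (∀ L ∈ l, L ∈ T) → freeCountR P₀ l ≤ k) →
      2 * T.card ≤ k * (k + 1)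
  | 0, T, hT, _, hk => by
    rcases Finset.eq_empty_or_nonempty T with hempty | ⟨L, hL⟩
    · subst hempty; simp
    · exfalso
      have h := hk [L] (List.nodup_singleton L) (by simpa using hL)
      obtain ⟨hL3, hLP⟩ := hT L hL
      have hsd : 0 < (L \ P₀).card := by
        have := Finset.card_sdiff_add_card_inter L P₀
        omega
      obtain ⟨x, hx⟩ := Finset.card_pos.1 hsd
      rw [freeCountR_cons_of_new (Finset.mem_sdiff.1 hx).1 (Finset.mem_sdiff.1 hx).2 (by simp)] at h
      simp [freeCountR] at h
  | k + 1, T, hT, hpair, hk => by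
    rcases Finset.eq_empty_or_nonempty T with hempty | ⟨L₀, hL₀⟩
    · subst hempty; simp
    obtain ⟨hL3, hLP⟩ := hT L₀ hL₀
    have hsd : 0 < (L₀ \ P₀).card := by
      have := Finset.card_sdiff_add_card_inter L₀ P₀
      omega
    obtain ⟨v, hv⟩ := Finset.card_pos.1 hsd
    have hvL : v ∈ L₀ := (Finset.mem_sdiff.1 hv).1
    have hvP : v ∉ P₀ := (Finset.mem_sdiff.1 hv).2
    -- the lines through `v`: at most `k + 1`
    have hA : (T.filter (fun L => v ∈ L)).card ≤ k + 1 :=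
      card_filter_le_of_freeCountR_le P₀ T hvP hT hpair hk
    -- the lines avoiding `v`: budget `k`
    set B := T.filter (fun L => ¬ v ∈ L) with hB
    have hBk : ∀ l : List (Finset β), l.Nodup → (∀ L ∈ l, L ∈ B) → freeCountR P₀ l ≤ k := by
      intro l hnd hl
      have hvl : ∀ L ∈ l, v ∉ L := fun L hL => (Finset.mem_filter.1 (hl L hL)).2
      have hnot : L₀ ∉ l := fun h => hvl L₀ h hvL
      have h := hk (L₀ :: l) (List.nodup_cons.2 ⟨hnot, hnd⟩)
        (fun L hL => by
          rcases List.mem_cons.1 hL with rfl | hL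
          · exact hL₀
          · exact (Finset.mem_filter.1 (hl L hL)).1)
      rw [freeCountR_cons_of_new hvL hvP hvl] at h
      omega
    have ih := two_mul_card_le_of_freeCountR P₀ k B
      (fun L hL => hT L (Finset.mem_filter.1 hL).1)
      (fun L hL L' hL' hne => hpair L (Finset.mem_filter.1 hL).1 L' (Finset.mem_filter.1 hL').1 hne) hBk
    have hsplit := Finset.card_filter_add_card_filter_not (s := T) (fun L => v ∈ L)
    rw [← hB] at hsplit
    have e1 : (k + 1) * (k + 1 + 1) = k * (k + 1) + (k + 1) + (k + 1) := by
      rw [Nat.mul_succ, Nat.succ_mul]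
    rw [e1]
    generalize k * (k + 1) = m at *
    omega

end FourCap

end S1

end PercRepro
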